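import Summits.Ventures.PercRepro.S1NineSixKillsSevenEleven

/-!
# PercRepro — RANK 7 ON 11: THE COMPLEMENTS BY SIZE AND THE PARTITION UPPER BOUNDS (p2, gen 28; SUBCLAIM-S1
§6.10 (xvii)(q); towards the `(9, 6)` shapes)

`N(7, 4) ≤ s₇`, `N(7, 3) ≤ q₃ + s₈`, `N(7, 2) ≤ q₂ + t + s₉` (a spanning set with a complement of rank `b` has size
`7`, `7–8`, `7–9`), and the rank classes of the `k`-sets are disjoint, so their counts add up to at most `C(11, k)`.
Nothing is claimed about any cell.

* `complements_rank_seven_eleven`, `rank_classes_eleven_le`, `rank_classes_eleven_le'`, `rank_three_triples_closure_le_six`.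
Axioms: standard.
-/

open scoped Matroid

namespace PercRepro

namespace S1

open Set

variable {α : Type} {M : Matroid α} [M.Finite]

/-- The sizes of a member of `N(7, k)` on `11` points. -/
theorem sizes_of_profileSet_seven (hE : M.E.ncard = 11) {k : ℕ} {A : Set α} (hA : A ∈ profileSet M 7 k) :
    7 ≤ A.ncard ∧ k ≤ (M.E \ A).ncard ∧ A.ncard + (M.E \ A).ncard = 11 := by
  obtain ⟨hAE, hA7, hAc⟩ := hA
  have hAfin : A.Finite := M.ground_finite.subset hAE
  have h1 : ((7 : ℕ) : ℕ∞) ≤ (A.ncard : ℕ∞) := by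
    rw [← hA7, hAfin.cast_ncard_eq]; exact M.eRk_le_encard A
  have h2 : ((k : ℕ) : ℕ∞) ≤ ((M.E \ A).ncard : ℕ∞) := by
    rw [← hAc, (M.ground_finite.subset sdiff_subset).cast_ncard_eq]; exact M.eRk_le_encard _
  have h3 : A.ncard + (M.E \ A).ncard = M.E.ncard := by
    rw [← ncard_union_eq disjoint_sdiff_right hAfin (M.ground_finite.subset sdiff_subset), union_sdiff_cancel hAE]
  exact ⟨by exact_mod_cast h1, by exact_mod_cast h2, by rw [h3, hE]⟩

/-- The complements: `N(7, 4) ≤ s₇`, `N(7, 3) ≤ q₃ + s₈`, `N(7, 2) ≤ q₂ + t + s₉`. -/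
theorem complements_rank_seven_eleven (hE : M.E.ncard = 11) :
    (profileSet M 7 4).ncard ≤ (rkSets M 7 7).ncard ∧
    (profileSet M 7 3).ncard ≤ (rkSets M 4 3).ncard + (rkSets M 8 7).ncard ∧
    (profileSet M 7 2).ncard ≤ (rankTwoSets M 4).ncard + (rankTwoSets M 3).ncard + (rkSets M 9 7).ncard := by
  refine ⟨?_, ?_, ?_⟩
  · refine ncard_le_ncard (fun A hA => ?_) (rkSets_finite 7 7)
    obtain ⟨h1, h2, h3⟩ := sizes_of_profileSet_seven hE hA
    exact ⟨hA.1, by omega, hA.2.1⟩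
  · have hsub : profileSet M 7 3 ⊆ (fun T => M.E \ T) '' rkSets M 4 3 ∪ rkSets M 8 7 := by
      intro A hA
      obtain ⟨h1, h2, h3⟩ := sizes_of_profileSet_seven hE hA
      obtain ⟨hAE, hA7, hAc⟩ := hA
      rcases Nat.lt_or_ge A.ncard 8 with h | h
      · left; exact ⟨M.E \ A, ⟨sdiff_subset, by omega, hAc⟩, sdiff_sdiff_cancel_left hAE⟩
      · right; exact ⟨hAE, by omega, hA7⟩
    have h := ncard_le_ncard hsub (((rkSets_finite 4 3).image _).union (rkSets_finite 8 7))
    exact h.trans ((ncard_union_le _ _).trans (Nat.add_le_add_right (ncard_image_le (rkSets_finite 4 3)) _))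
  · have hsub : profileSet M 7 2 ⊆ (fun T => M.E \ T) '' rankTwoSets M 4 ∪ (fun T => M.E \ T) '' rankTwoSets M 3 ∪
        rkSets M 9 7 := by
      intro A hA
      obtain ⟨h1, h2, h3⟩ := sizes_of_profileSet_seven hE hA
      obtain ⟨hAE, hA7, hAc⟩ := hA
      rcases Nat.lt_or_ge A.ncard 8 with h | h
      · left; left; exact ⟨M.E \ A, ⟨sdiff_subset, by omega, hAc⟩, sdiff_sdiff_cancel_left hAE⟩
      rcases Nat.lt_or_ge A.ncard 9 with h' | h'
      · left; right; exact ⟨M.E \ A, ⟨sdiff_subset, by omega, hAc⟩, sdiff_sdiff_cancel_left hAE⟩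
      · right; exact ⟨hAE, by omega, hA7⟩
    have h := ncard_le_ncard hsub ((((rankTwoSets_finite M 4).image _).union ((rankTwoSets_finite M 3).image _)).union
      (rkSets_finite 9 7))
    refine h.trans ((ncard_union_le _ _).trans ?_)
    exact Nat.add_le_add_right ((ncard_union_le _ _).trans (Nat.add_le_add (ncard_image_le (rankTwoSets_finite M 4))
      (ncard_image_le (rankTwoSets_finite M 3)))) _

/-- The six rank classes of the `k`-sets are disjoint: their counts add up to at most `C(11, k)`. -/
theorem rank_classes_eleven_le (hE : M.E.ncard = 11) (k : ℕ) :
    (rankTwoSets M k).ncard + (rkSets M k 3).ncard + (rkSets M k 4).ncard + (rkSets M k 5).ncard +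
      (rkSets M k 6).ncard + (rkSets M k 7).ncard ≤ Nat.choose 11 k := by
  have hf : {A : Set α | A ⊆ M.E ∧ A.ncard = k}.Finite := M.ground_finite.finite_subsets.subset (fun _ hA => hA.1)
  have hsub : rankTwoSets M k ∪ rkSets M k 3 ∪ rkSets M k 4 ∪ rkSets M k 5 ∪ rkSets M k 6 ∪ rkSets M k 7 ⊆
      {A : Set α | A ⊆ M.E ∧ A.ncard = k} := by
    rintro A (((((⟨hAE, hk, -⟩ | ⟨hAE, hk, -⟩) | ⟨hAE, hk, -⟩) | ⟨hAE, hk, -⟩) | ⟨hAE, hk, -⟩) | ⟨hAE, hk, -⟩) <;>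
      exact ⟨hAE, hk⟩
  have h := ncard_le_ncard hsub hf
  have d2 : ∀ n : ℕ, n ≠ 2 → Disjoint (rankTwoSets M k) (rkSets M k n) := by
    intro n hn
    rw [Set.disjoint_left]
    rintro A ⟨-, -, h2⟩ ⟨-, -, hn'⟩
    apply hn
    have : ((2 : ℕ) : ℕ∞) = (n : ℕ∞) := by rw [← hn']; exact h2.symm
    exact (by exact_mod_cast this : 2 = n).symm
  have dn : ∀ m n : ℕ, m ≠ n → Disjoint (rkSets M k m) (rkSets M k n) := by
    intro m n hmn
    rw [Set.disjoint_left]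
    rintro A ⟨-, -, hm⟩ ⟨-, -, hn⟩
    apply hmn
    have : (m : ℕ∞) = (n : ℕ∞) := by rw [← hm, ← hn]
    exact_mod_cast this
  rw [ncard_union_eq (by
        rw [Set.disjoint_left]
        rintro A ((((hA | hA) | hA) | hA) | hA) hB
        · exact (d2 7 (by norm_num)).notMem_of_mem_left hA hB
        all_goals exact (dn _ 7 (by norm_num)).notMem_of_mem_left hA hB)
      (((((rankTwoSets_finite M k).union (rkSets_finite k 3)).union (rkSets_finite k 4)).union (rkSets_finite k 5)).union
        (rkSets_finite k 6)) (rkSets_finite k 7),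
    ncard_union_eq (by
        rw [Set.disjoint_left]
        rintro A (((hA | hA) | hA) | hA) hB
        · exact (d2 6 (by norm_num)).notMem_of_mem_left hA hB
        all_goals exact (dn _ 6 (by norm_num)).notMem_of_mem_left hA hB)
      ((((rankTwoSets_finite M k).union (rkSets_finite k 3)).union (rkSets_finite k 4)).union (rkSets_finite k 5))
      (rkSets_finite k 6),
    ncard_union_eq (by
        rw [Set.disjoint_left]
        rintro A ((hA | hA) | hA) hB
        · exact (d2 5 (by norm_num)).notMem_of_mem_left hA hB
        all_goals exact (dn _ 5 (by norm_num)).notMem_of_mem_left hA hB)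
      (((rankTwoSets_finite M k).union (rkSets_finite k 3)).union (rkSets_finite k 4)) (rkSets_finite k 5),
    ncard_union_eq (by
        rw [Set.disjoint_left]
        rintro A (hA | hA) hB
        · exact (d2 4 (by norm_num)).notMem_of_mem_left hA hB
        · exact (dn _ 4 (by norm_num)).notMem_of_mem_left hA hB)
      ((rankTwoSets_finite M k).union (rkSets_finite k 3)) (rkSets_finite k 4),
    ncard_union_eq (d2 3 (by norm_num)) (rankTwoSets_finite M k) (rkSets_finite k 3),
    ncard_setOf_subset_ncard_eq M.ground_finite k, hE] at h
  exact h

/-- The partitions as upper bounds, with the empty classes removed (the counterpart of `rank_classes_eleven`). -/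
theorem rank_classes_eleven_le' (hM : M.eRank = ((7 : ℕ) : ℕ∞)) (hE : M.E.ncard = 11) (hcol : M.coloops = ∅) :
    (rankTwoSets M 3).ncard + (rkSets M 3 3).ncard ≤ 165 ∧
    (rankTwoSets M 4).ncard + (rkSets M 4 3).ncard + (rkSets M 4 4).ncard ≤ 330 ∧
    (rankTwoSets M 5).ncard + (rkSets M 5 3).ncard + (rkSets M 5 4).ncard + (rkSets M 5 5).ncard ≤ 462 ∧
    (rkSets M 6 3).ncard + (rkSets M 6 4).ncard + (rkSets M 6 5).ncard + (rkSets M 6 6).ncard ≤ 462 ∧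
    (rkSets M 7 4).ncard + (rkSets M 7 5).ncard + (rkSets M 7 6).ncard + (rkSets M 7 7).ncard ≤ 330 ∧
    (rkSets M 8 5).ncard + (rkSets M 8 6).ncard + (rkSets M 8 7).ncard ≤ 165 ∧
    (rkSets M 9 6).ncard + (rkSets M 9 7).ncard ≤ 55 ∧
    (rkSets M 10 7).ncard ≤ 11 := by
  have e_lt : ∀ {k n : ℕ}, k < n → rkSets M k n = ∅ := fun h => rkSets_eq_empty_of_lt h
  have e_big := fun {k n : ℕ} (hn : n < 7) (hk : 11 < k + (7 - n + 1)) =>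
    rkSets_eq_empty_of_big_eleven hM hE hcol (k := k) (n := n) hn hk
  have e_two := fun {k : ℕ} (hk : 5 < k) => rankTwoSets_eq_empty_of_big_eleven hM hE hcol (k := k) hk
  refine ⟨?_, ?_, ?_, ?_, ?_, ?_, ?_, ?_⟩
  · have := rank_classes_eleven_le hE 3
    rw [e_lt (k := 3) (n := 4) (by norm_num), e_lt (k := 3) (n := 5) (by norm_num), e_lt (k := 3) (n := 6) (by norm_num),
      e_lt (k := 3) (n := 7) (by norm_num), ncard_empty, show Nat.choose 11 3 = 165 by decide] at this
    omega
  · have := rank_classes_eleven_le hE 4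
    rw [e_lt (k := 4) (n := 5) (by norm_num), e_lt (k := 4) (n := 6) (by norm_num), e_lt (k := 4) (n := 7) (by norm_num),
      ncard_empty, show Nat.choose 11 4 = 330 by decide] at this
    omega
  · have := rank_classes_eleven_le hE 5
    rw [e_lt (k := 5) (n := 6) (by norm_num), e_lt (k := 5) (n := 7) (by norm_num), ncard_empty,
      show Nat.choose 11 5 = 462 by decide] at this
    omega
  · have := rank_classes_eleven_le hE 6
    rw [e_two (k := 6) (by norm_num), e_lt (k := 6) (n := 7) (by norm_num), ncard_empty,
      show Nat.choose 11 6 = 462 by decide] at this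
    omega
  · have := rank_classes_eleven_le hE 7
    rw [e_two (k := 7) (by norm_num), e_big (k := 7) (n := 3) (by norm_num) (by norm_num), ncard_empty,
      show Nat.choose 11 7 = 330 by decide] at this
    omega
  · have := rank_classes_eleven_le hE 8
    rw [e_two (k := 8) (by norm_num), e_big (k := 8) (n := 3) (by norm_num) (by norm_num),
      e_big (k := 8) (n := 4) (by norm_num) (by norm_num), ncard_empty, show Nat.choose 11 8 = 165 by decide] at this
    omega
  · have := rank_classes_eleven_le hE 9
    rw [e_two (k := 9) (by norm_num), e_big (k := 9) (n := 3) (by norm_num) (by norm_num),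
      e_big (k := 9) (n := 4) (by norm_num) (by norm_num), e_big (k := 9) (n := 5) (by norm_num) (by norm_num),
      ncard_empty, show Nat.choose 11 9 = 55 by decide] at this
    omega
  · have := rank_classes_eleven_le hE 10
    rw [e_two (k := 10) (by norm_num), e_big (k := 10) (n := 3) (by norm_num) (by norm_num),
      e_big (k := 10) (n := 4) (by norm_num) (by norm_num), e_big (k := 10) (n := 5) (by norm_num) (by norm_num),
      e_big (k := 10) (n := 6) (by norm_num) (by norm_num), ncard_empty, show Nat.choose 11 10 = 11 by decide] at this
    omega

/-- On `11` points of rank `7`, coloop-free: a rank-`3` triple spans at most `6` points. -/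
theorem rank_three_triples_closure_le_six (hM : M.eRank = ((7 : ℕ) : ℕ∞)) (hE : M.E.ncard = 11)
    (hcol : M.coloops = ∅) : ∀ T ∈ rkSets M 3 3, (M.closure T).ncard ≤ 6 := by
  rintro T ⟨hTE, -, hT3⟩
  have hcl : M.eRk (M.closure T) = ((3 : ℕ) : ℕ∞) := by rw [M.eRk_closure_eq, hT3]
  have hmiss := sub_add_one_le_ncard_ground_sdiff_of_coloops M hM hcol (M.closure_subset_ground T) hcl (by norm_num)
  rw [ncard_sdiff' (M.closure_subset_ground T) M.ground_finite, hE] at hmiss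
  have := ncard_le_ncard (M.closure_subset_ground T) M.ground_finite
  rw [hE] at this
  omega

end S1

end PercRepro
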